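import Summits.QuantumFields.GaugeBoot.EquipartitionBootstrapZd
import Summits.QuantumFields.GaugeBoot.BootstrapBoundsConvergenceZd
import Summits.QuantumFields.GaugeBoot.HaarShiftUniqueness
import Summits.QuantumFields.GaugeBoot.LoopEquationInstances
import HarnessLib

/-!
# Gauge-boot: THE EQUIPARTITION BOUND FOR EVERY INFINITE-VOLUME GIBBS (DLR) STATE OF LATTICE `SU(N)`
# YANG–MILLS ON `ℤ^d`, FOR EVERY CLASS-B STATE, AND FOR THE (REDUCED) INFINITE-LATTICE SDP VALUES
# (large-`N` supplement 19, part 5)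

HONEST FRAMING (cell `pub-gaugeboot`, page 1 of every file): certified bounds on lattice
expectations at STATED coupling, gauge group, dimension and torus size; NOT a mass gap, NOT a
continuum limit, NOT a string tension, NOT large `N`; NOT Yang–Mills-summit-bearing (barriers
`FixedCouplingUltralocality`, `PerturbativeInvisibility`).  Analytic a-priori bounds, weaker than the SDP
certificates of CERTIFIED.md and not among its numbers; unconditional and volume-independent.

## Content

Part 4 (`EquipartitionBootstrapZd`) bounds the link-averaged plaquette at every feasible point of the word-level-`≥ 4`
bootstrap on `ℤ^d`.  The expectation functional of a DLR state is feasible at every level (`isBootstrapFeasible_dlr_suN`,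
the one-link DLR equations ARE the Schwinger–Dyson rows), so — with `δ = (N − 1/N)/(4(d−1)β + N − 1/N)` at tree
coupling `β ≥ 0`, i.e. `δ = (N² − 1)/(4(d−1)β_std + N² − 1)`, `N ≥ 2`, `d ≥ 2`:

* ★★★ `sum_integral_plaquette_le_of_mem_ymGibbsMeasures` — for EVERY infinite-volume Gibbs state `μ ∈ 𝒢(β)` of `SU(N)`
  on `ℤ^d` and every link `(x, a)`: `Σ_{ν≠a} (∫ u_{x;aν} dμ + ∫ u_{x−e_ν;aν} dμ) ≤ 2(d−1)(1 − δ)` — the `2(d−1)`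
  plaquettes through the link have mean deficit at least `δ`; `…_of_isHaarShiftState` (one-link Haar-shift = loop-equation
  states), `…_std` (cell normalisation);
* ★★★ `sum_integral_plaquette_le_of_translationInvariant` — for a TRANSLATION-INVARIANT Gibbs state the plane sum obeys
  `Σ_{ν≠a} ∫ u_{x;aν} dμ ≤ (d−1)(1 − δ)` (in `d = 2`: `∫ u_P dμ ≤ 1 − δ` for the one plane);
* ★★★ `ClassBState.integral_plaquette_le` / `_std` — for every CLASS-B state `ω` (the states a Class-B certificate of
  the cell quantifies over: DLR + `ℤ^d ⋊ B_d`-invariant + RP) and EVERY plaquette: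
  **`∫ u_{x;ij} dω ≤ 1 − (N² − 1)/(4(d−1)β_std + N² − 1)`** (translation and axis-permutation invariance identify all
  plaquette expectations);
* set forms: `dlrValues_linkPlaquetteSum_le`, `levelValuesZd_linkPlaquetteSum_le` (every value of the link plaquette sum
  `linkPlaquetteSumCM` over the DLR states / over the plain level-`n ≥ 4` SDP on `ℤ^d`),
  ★★ `sum_plaquette_le_of_translationInvariant_feasible` / `symLevelValuesZd_planeSum_le` (the translation-REDUCED SDP
  of Anderson–Kruczenski / Kazakov–Zheng at level `n ≥ 4`: `Σ_{ν≠a} φ(u_{x;aν}) ≤ (d−1)(1 − δ)`).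
[folklore] (equipartition from the one-link Schwinger–Dyson / DLR equation; M. Creutz, *Quarks, gluons and lattices* (1983)
Ch. 11; S. Chatterjee, arXiv:1502.07719 §3; H.-O. Georgii, *Gibbs Measures and Phase Transitions* (2011) Ch. 5.)
-/

noncomputable section

open MeasureTheory Filter Topology NormedSpace
open scoped Matrix
open Literature.Probability.LatticeModels (Site)
open Literature.MathematicalPhysics.QuantumFieldTheory (LatticeRep configPermZd)
open Literature.MathematicalPhysics.QuantumLattice (fundamentalLatticeRep fundamentalRep fundamentalLatticeRep_N LGConfig
  ZdEdge plaquetteObs plaquetteHolonomyZd wilsonBoundaryAction ymGibbsMeasures IsZdTranslationInvariant configShift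
  edgeShift continuous_fundamentalRep plaquetteHolonomyZd_configShift_add)

namespace Summit.QuantumFields.GaugeBoot

namespace EquipartitionZd

open TiltedRP (plaquetteZdCM plaquetteZdCM_apply plaquetteZdCM_mem_wordTruncation zdUnit zdUnit_apply)

variable {d N : ℕ}

/-- The equipartition ceiling `2(d−1)·(1 − (N − 1/N)/(4(d−1)β + N − 1/N))` for the sum of the `2(d−1)` plaquettes
through a link (tree coupling `β`). [folklore] -/
def linkBound (d N : ℕ) (β : ℝ) : ℝ :=
  2 * ((d : ℝ) - 1) * (1 - ((N : ℝ) - 1 / N) / (4 * ((d : ℝ) - 1) * β + ((N : ℝ) - 1 / N)))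

/-- Unfolding lemma. [folklore] -/
theorem linkBound_eq (d N : ℕ) (β : ℝ) : linkBound d N β =
    2 * ((d : ℝ) - 1) * (1 - ((N : ℝ) - 1 / N) / (4 * ((d : ℝ) - 1) * β + ((N : ℝ) - 1 / N))) := rfl

/-- **Cell normalisation**: at `β = β_std/N` the per-plaquette ceiling is `1 − (N² − 1)/(4(d−1)β_std + N² − 1)`. [folklore] -/
theorem linkBound_div (hN : 2 ≤ N) (hd : 2 ≤ d) {β : ℝ} (hβ : 0 ≤ β) :
    linkBound d N (β / N) = 2 * ((d : ℝ) - 1) * (1 - ((N : ℝ) ^ 2 - 1) / (4 * ((d : ℝ) - 1) * β + ((N : ℝ) ^ 2 - 1))) := by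
  rw [linkBound_eq]
  have hd1 : (0 : ℝ) ≤ (d : ℝ) - 1 := by
    have : (2 : ℝ) ≤ d := by exact_mod_cast hd
    linarith
  have hN2 : (2 : ℝ) ≤ N := by exact_mod_cast hN
  have hN1 : (1 : ℝ) < (N : ℝ) ^ 2 := by nlinarith
  have hcpos : (0 : ℝ) < (N : ℝ) - 1 / N := by
    have h1 : 1 / (N : ℝ) ≤ 1 / 2 := one_div_le_one_div_of_le (by norm_num) hN2
    linarith
  have hK1 : (0 : ℝ) < 4 * ((d : ℝ) - 1) * (β / N) + ((N : ℝ) - 1 / N) :=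
    add_pos_of_nonneg_of_pos (mul_nonneg (mul_nonneg (by norm_num) hd1) (div_nonneg hβ (by linarith))) hcpos
  have hK2 : (0 : ℝ) < 4 * ((d : ℝ) - 1) * β + ((N : ℝ) ^ 2 - 1) :=
    add_pos_of_nonneg_of_pos (mul_nonneg (mul_nonneg (by norm_num) hd1) hβ) (by linarith)
  have hid : ((N : ℝ) - 1 / N) / (4 * ((d : ℝ) - 1) * (β / N) + ((N : ℝ) - 1 / N)) =
      ((N : ℝ) ^ 2 - 1) / (4 * ((d : ℝ) - 1) * β + ((N : ℝ) ^ 2 - 1)) := by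
    rw [div_eq_div_iff hK1.ne' hK2.ne']
    field_simp
  rw [hid]

/-! ## Every infinite-volume Gibbs state -/

section DLR

/-- ★★★ **THE EQUIPARTITION BOUND FOR EVERY INFINITE-VOLUME GIBBS STATE.**  `SU(N)` lattice Yang–Mills on `ℤ^d`
(`N ≥ 2`, `d ≥ 2`), Wilson action at tree coupling `β ≥ 0` (`β = β_std/N`), `μ ∈ 𝒢(β)` ANY DLR state, `(x, a)` any
link: `Σ_{ν ≠ a} (∫ u_{x;aν} dμ + ∫ u_{x−e_ν;aν} dμ) ≤ 2(d−1)·(1 − (N − 1/N)/(4(d−1)β + N − 1/N))`,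
`u_{y;ij} = (1/N) Re tr U_{y;ij}`. [folklore] -/
theorem sum_integral_plaquette_le_of_mem_ymGibbsMeasures (hN : 2 ≤ N) (hd : 2 ≤ d) {β : ℝ} (hβ : 0 ≤ β)
    {μ : Measure (LGConfig d (Matrix.specialUnitaryGroup (Fin N) ℂ))}
    (hμ : μ ∈ ymGibbsMeasures (d := d) (fundamentalRep (Fin N)) β) (x : Site d) (a : Fin d) :
    (∑ ν ∈ Finset.univ.erase a, (∫ U, (N : ℝ)⁻¹ * plaquetteObs (fundamentalRep (Fin N)) x a ν U ∂μ +
        ∫ U, (N : ℝ)⁻¹ * plaquetteObs (fundamentalRep (Fin N)) (x - zdUnit d ν) a ν U ∂μ)) ≤ linkBound d N β := by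
  haveI := hμ.1
  have hφ := isBootstrapFeasible_dlr_suN N β hμ (wordTruncation_subset_polyAlgebra (fundamentalLatticeRep N) 4)
  have h := TiltedRP.Equipartition.sum_plaquette_le_of_isBootstrapFeasible_zdSuN hN le_rfl hd hβ hφ x a
  simpa only [expectationFunctional_apply, plaquetteZdCM_apply, fundamentalLatticeRep_N, fundamentalLatticeRep_ρ,
    linkBound_eq] using h

/-- **Cell normalisation.**  For `μ ∈ 𝒢(β_std/N)`:
`Σ_{ν ≠ a} (∫ u_{x;aν} + ∫ u_{x−e_ν;aν}) ≤ 2(d−1)·(1 − (N² − 1)/(4(d−1)β_std + N² − 1))`. [folklore] -/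
theorem sum_integral_plaquette_le_of_mem_ymGibbsMeasures_std (hN : 2 ≤ N) (hd : 2 ≤ d) {β : ℝ} (hβ : 0 ≤ β)
    {μ : Measure (LGConfig d (Matrix.specialUnitaryGroup (Fin N) ℂ))}
    (hμ : μ ∈ ymGibbsMeasures (d := d) (fundamentalRep (Fin N)) (β / N)) (x : Site d) (a : Fin d) :
    (∑ ν ∈ Finset.univ.erase a, (∫ U, (N : ℝ)⁻¹ * plaquetteObs (fundamentalRep (Fin N)) x a ν U ∂μ +
        ∫ U, (N : ℝ)⁻¹ * plaquetteObs (fundamentalRep (Fin N)) (x - zdUnit d ν) a ν U ∂μ)) ≤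
      2 * ((d : ℝ) - 1) * (1 - ((N : ℝ) ^ 2 - 1) / (4 * ((d : ℝ) - 1) * β + ((N : ℝ) ^ 2 - 1))) := by
  have hN0 : (0 : ℝ) < N := by exact_mod_cast (by omega : 0 < N)
  rw [← linkBound_div hN hd hβ]
  exact sum_integral_plaquette_le_of_mem_ymGibbsMeasures hN hd (div_nonneg hβ hN0.le) hμ x a

/-- ★★★ **The same for every HAAR-SHIFT (one-link Gibbs / loop-equation) probability state** — the class of states the
lattice bootstrap on `ℤ^d` quantifies over (`isHaarShiftState_iff_mem_ymGibbsMeasures`). [folklore] -/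
theorem sum_integral_plaquette_le_of_isHaarShiftState (hN : 2 ≤ N) (hd : 2 ≤ d) {β : ℝ} (hβ : 0 ≤ β)
    {μ : Measure (LGConfig d (Matrix.specialUnitaryGroup (Fin N) ℂ))} [IsProbabilityMeasure μ]
    (hμ : IsHaarShiftState (fundamentalRep (Fin N)) β μ) (x : Site d) (a : Fin d) :
    (∑ ν ∈ Finset.univ.erase a, (∫ U, (N : ℝ)⁻¹ * plaquetteObs (fundamentalRep (Fin N)) x a ν U ∂μ +
        ∫ U, (N : ℝ)⁻¹ * plaquetteObs (fundamentalRep (Fin N)) (x - zdUnit d ν) a ν U ∂μ)) ≤ linkBound d N β := by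
  haveI : SecondCountableTopology (Matrix (Fin N) (Fin N) ℂ) :=
    inferInstanceAs (SecondCountableTopology (Fin N → Fin N → ℂ))
  haveI : SecondCountableTopology (Matrix.specialUnitaryGroup (Fin N) ℂ) :=
    Topology.IsEmbedding.subtypeVal.secondCountableTopology
  exact sum_integral_plaquette_le_of_mem_ymGibbsMeasures hN hd hβ
    (mem_ymGibbsMeasures_of_isHaarShiftState (fundamentalRep (Fin N)) (continuous_fundamentalRep _) hμ) x a

end DLR

/-! ## Translation-invariant states: the plane sum -/

section Invariant

/-- In a translation-invariant state the plaquette at `x − v` has the expectation of the plaquette at `x`. [folklore] -/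
theorem integral_plaquetteObs_sub_eq_of_translationInvariant {G : Type} [Group G] [MeasurableSpace G]
    (ρ : G →* Matrix (Fin N) (Fin N) ℂ) {μ : Measure (LGConfig d G)} (hT : IsZdTranslationInvariant μ)
    (x v : Site d) (i j : Fin d) (c : ℝ) :
    ∫ U, c * plaquetteObs ρ (x - v) i j U ∂μ = ∫ U, c * plaquetteObs ρ x i j U ∂μ := by
  conv_rhs => rw [← hT v]
  rw [integral_map_equiv]
  refine integral_congr_ae (ae_of_all _ fun U => ?_)
  have h := plaquetteHolonomyZd_configShift_add v U (x - v) i j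
  rw [sub_add_cancel] at h
  simp only [plaquetteObs, h]

/-- ★★★ **TRANSLATION-INVARIANT GIBBS STATES: THE PLANE SUM.**  For `μ ∈ 𝒢(β)` translation invariant (`N ≥ 2`, `d ≥ 2`,
`β ≥ 0`), every site `x` and axis `a`: `Σ_{ν ≠ a} ∫ u_{x;aν} dμ ≤ (d−1)·(1 − (N − 1/N)/(4(d−1)β + N − 1/N))`; for `d = 2`
this is the equipartition bound for the single plaquette. [folklore] -/
theorem sum_integral_plaquette_le_of_translationInvariant (hN : 2 ≤ N) (hd : 2 ≤ d) {β : ℝ} (hβ : 0 ≤ β)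
    {μ : Measure (LGConfig d (Matrix.specialUnitaryGroup (Fin N) ℂ))}
    (hμ : μ ∈ ymGibbsMeasures (d := d) (fundamentalRep (Fin N)) β) (hT : IsZdTranslationInvariant μ)
    (x : Site d) (a : Fin d) :
    (∑ ν ∈ Finset.univ.erase a, ∫ U, (N : ℝ)⁻¹ * plaquetteObs (fundamentalRep (Fin N)) x a ν U ∂μ) ≤
      ((d : ℝ) - 1) * (1 - ((N : ℝ) - 1 / N) / (4 * ((d : ℝ) - 1) * β + ((N : ℝ) - 1 / N))) := by
  have h := sum_integral_plaquette_le_of_mem_ymGibbsMeasures hN hd hβ hμ x a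
  simp only [integral_plaquetteObs_sub_eq_of_translationInvariant (fundamentalRep (Fin N)) hT, ← two_mul,
    ← Finset.mul_sum, linkBound_eq] at h
  linarith

end Invariant

/-! ## Class-B states: every plaquette -/

section ClassB

/-- In a Class-B state every plaquette has the expectation of any plaquette at the origin (translation and
axis-permutation invariance). [folklore] -/
theorem ClassBState.integral_plaquetteObs_eq {β : ℝ} (ω : ClassBState d (fundamentalRep (Fin N)) β) (x : Site d)
    {i j a b : Fin d} (hij : i ≠ j) (hab : a ≠ b) (c : ℝ) :
    ∫ U, c * plaquetteObs (fundamentalRep (Fin N)) x a b U ∂ω.μ =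
      ∫ U, c * plaquetteObs (fundamentalRep (Fin N)) 0 i j U ∂ω.μ := by
  have h1 := integral_plaquetteObs_sub_eq_of_translationInvariant (fundamentalRep (Fin N)) ω.translationInvariant
    0 (-x) a b c
  rw [zero_sub, neg_neg] at h1
  rw [h1, integral_const_mul, integral_const_mul]
  congr 1
  have hperm : ∀ π : Equiv.Perm (Fin d),
      ω.μ.map (configPermZd (G := Matrix.specialUnitaryGroup (Fin N) ℂ) π) = ω.μ := fun π => by
    have h := (ω.permInvariant π).map_eq
    rwa [configPerm_eq_configPermZd] at h
  exact integral_plaquetteObs_zero_eq_of_map_configPermZd (fundamentalRep (Fin N)) hperm hij hab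

/-- ★★★ **THE EQUIPARTITION BOUND FOR EVERY CLASS-B STATE AND EVERY PLAQUETTE.**  `SU(N)`, `N ≥ 2`, `d ≥ 2`, tree
coupling `β ≥ 0`, `ω` a Class-B state (DLR, `ℤ^d ⋊ B_d`-invariant, reflection positive — the states a Class-B
certificate of the cell bounds): for every plaquette `(x; i ≠ j)`,
`∫ (1/N) Re tr U_{x;ij} dω ≤ 1 − (N − 1/N)/(4(d−1)β + N − 1/N)`. [folklore] -/
theorem ClassBState.integral_plaquette_le (hN : 2 ≤ N) (hd : 2 ≤ d) {β : ℝ} (hβ : 0 ≤ β)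
    (ω : ClassBState d (fundamentalRep (Fin N)) β) (x : Site d) {i j : Fin d} (hij : i ≠ j) :
    ∫ U, (N : ℝ)⁻¹ * plaquetteObs (fundamentalRep (Fin N)) x i j U ∂ω.μ ≤
      1 - ((N : ℝ) - 1 / N) / (4 * ((d : ℝ) - 1) * β + ((N : ℝ) - 1 / N)) := by
  haveI := ω.isProbabilityMeasure
  have hμ := ω.mem_ymGibbsMeasures (fundamentalRep (Fin N)) (continuous_fundamentalRep _)
  have h := sum_integral_plaquette_le_of_mem_ymGibbsMeasures hN hd hβ hμ x i
  -- every term of the link sum is the `(i, j)` plaquette at `x`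
  have hterm : ∀ ν ∈ Finset.univ.erase i,
      (∫ U, (N : ℝ)⁻¹ * plaquetteObs (fundamentalRep (Fin N)) x i ν U ∂ω.μ +
        ∫ U, (N : ℝ)⁻¹ * plaquetteObs (fundamentalRep (Fin N)) (x - zdUnit d ν) i ν U ∂ω.μ) =
      2 * ∫ U, (N : ℝ)⁻¹ * plaquetteObs (fundamentalRep (Fin N)) x i j U ∂ω.μ := by
    intro ν hν
    have hiν : i ≠ ν := (Finset.ne_of_mem_erase hν).symm
    rw [ClassBState.integral_plaquetteObs_eq ω x hij hiν, ClassBState.integral_plaquetteObs_eq ω (x - zdUnit d ν) hij hiν,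
      ClassBState.integral_plaquetteObs_eq ω x hij hij]
    ring
  rw [Finset.sum_congr rfl hterm, Finset.sum_const, Finset.card_erase_of_mem (Finset.mem_univ i), Finset.card_univ,
    Fintype.card_fin, nsmul_eq_mul, Nat.cast_sub (by omega : 1 ≤ d), Nat.cast_one, linkBound_eq] at h
  have hd0 : (0 : ℝ) < (d : ℝ) - 1 := by
    have : (2 : ℝ) ≤ d := by exact_mod_cast hd
    linarith
  nlinarith [h]

/-- **Cell normalisation**: for a Class-B state at `β_std/N`,
`∫ u_P dω ≤ 1 − (N² − 1)/(4(d−1)β_std + N² − 1)` for every plaquette (e.g. `SU(3)`, `d = 4`, `β_std = 6`: `≤ 9/10`;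
`SU(2)`, `d = 4`, `β_std = 2.5`: `≤ 10/11`). [folklore] -/
theorem ClassBState.integral_plaquette_le_std (hN : 2 ≤ N) (hd : 2 ≤ d) {β : ℝ} (hβ : 0 ≤ β)
    (ω : ClassBState d (fundamentalRep (Fin N)) (β / N)) (x : Site d) {i j : Fin d} (hij : i ≠ j) :
    ∫ U, (N : ℝ)⁻¹ * plaquetteObs (fundamentalRep (Fin N)) x i j U ∂ω.μ ≤
      1 - ((N : ℝ) ^ 2 - 1) / (4 * ((d : ℝ) - 1) * β + ((N : ℝ) ^ 2 - 1)) := by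
  have hN0 : (0 : ℝ) < N := by exact_mod_cast (by omega : 0 < N)
  have h := ClassBState.integral_plaquette_le hN hd (div_nonneg hβ hN0.le) ω x hij
  have hb := linkBound_div hN hd hβ
  rw [linkBound_eq] at hb
  have hd0 : (0 : ℝ) < 2 * ((d : ℝ) - 1) := by
    have : (2 : ℝ) ≤ d := by exact_mod_cast hd
    linarith
  have hb' := mul_left_cancel₀ hd0.ne' hb
  linarith [hb']

end ClassB

/-! ## Set forms: DLR values and the infinite-lattice SDPs -/

section Sets

variable (N) in
/-- **The link plaquette sum** `Σ_{ν ≠ a} (u_{x;aν} + u_{x−e_ν;aν})` — the `2(d−1)` normalised plaquettes through the link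
`(x, a)` — as one continuous observable. [folklore] -/
def linkPlaquetteSumCM (x : Site d) (a : Fin d) : C(LGConfig d (Matrix.specialUnitaryGroup (Fin N) ℂ), ℝ) :=
  ∑ ν ∈ Finset.univ.erase a, (plaquetteZdCM (fundamentalLatticeRep N) x a ν +
    plaquetteZdCM (fundamentalLatticeRep N) (x - zdUnit d ν) a ν)

/-- A linear functional on the link plaquette sum. [folklore] -/
theorem apply_linkPlaquetteSumCM (φ : C(LGConfig d (Matrix.specialUnitaryGroup (Fin N) ℂ), ℝ) →ₗ[ℝ] ℝ) (x : Site d)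
    (a : Fin d) : φ (linkPlaquetteSumCM N x a) = ∑ ν ∈ Finset.univ.erase a,
      (φ (plaquetteZdCM (fundamentalLatticeRep N) x a ν) + φ (plaquetteZdCM (fundamentalLatticeRep N) (x - zdUnit d ν) a ν)) := by
  simp only [linkPlaquetteSumCM, map_sum, map_add]

/-- ★★ **The plain level-`n` SDP on `ℤ^d` (`n ≥ 4`) cannot put the link plaquette sum above the equipartition
ceiling**: every `t ∈ levelValuesZdSuN N β n (linkPlaquetteSumCM N x a)` satisfies `t ≤ 2(d−1)(1 − δ)`. [folklore] -/
theorem levelValuesZd_linkPlaquetteSum_le (hN : 2 ≤ N) (hd : 2 ≤ d) {β : ℝ} (hβ : 0 ≤ β) {n : ℕ} (hn : 4 ≤ n)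
    (x : Site d) (a : Fin d) {t : ℝ} (ht : t ∈ levelValuesZdSuN (d := d) N β n (linkPlaquetteSumCM N x a)) :
    t ≤ linkBound d N β := by
  obtain ⟨φ, hφ, rfl⟩ := ht
  rw [apply_linkPlaquetteSumCM, linkBound_eq]
  exact TiltedRP.Equipartition.sum_plaquette_le_of_isBootstrapFeasible_zdSuN hN hn hd hβ hφ x a

/-- ★★ **Every DLR value of the link plaquette sum is below the ceiling** (`dlrValuesSuN`). [folklore] -/
theorem dlrValues_linkPlaquetteSum_le (hN : 2 ≤ N) (hd : 2 ≤ d) {β : ℝ} (hβ : 0 ≤ β) (x : Site d) (a : Fin d)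
    {t : ℝ} (ht : t ∈ dlrValuesSuN (d := d) N β (linkPlaquetteSumCM N x a)) : t ≤ linkBound d N β :=
  levelValuesZd_linkPlaquetteSum_le hN hd hβ le_rfl x a (dlrValues_subset_levelValuesZd_suN N β 4 _ ht)

/-- Hence `sSup (dlrValuesSuN … (linkPlaquetteSumCM N x a)) ≤ 2(d−1)(1 − δ)`. [folklore] -/
theorem sSup_dlrValues_linkPlaquetteSum_le (hN : 2 ≤ N) (hd : 2 ≤ d) {β : ℝ} (hβ : 0 ≤ β) (x : Site d) (a : Fin d) :
    sSup (dlrValuesSuN (d := d) N β (linkPlaquetteSumCM N x a)) ≤ linkBound d N β :=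
  csSup_le (dlrValues_nonempty_bdd_suN N β _).1 fun _ ht => dlrValues_linkPlaquetteSum_le hN hd hβ x a ht

/-- Translating the plaquette observable: `u_{x;aν} ∘ τ_v = u_{x+v;aν}`. [folklore] -/
theorem plaquetteZdCM_comp_relabelCM_edgeShift (x : Site d) (a ν : Fin d) (v : Site d) :
    (plaquetteZdCM (fundamentalLatticeRep N) x a ν).comp
        (relabelCM (G := Matrix.specialUnitaryGroup (Fin N) ℂ) (edgeShift v)) =
      plaquetteZdCM (fundamentalLatticeRep N) (x + v) a ν := by
  ext U
  rw [ContinuousMap.comp_apply, plaquetteZdCM_apply, plaquetteZdCM_apply, plaquetteObs, plaquetteObs]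
  have h := plaquetteHolonomyZd_configShift_add (-v) U (x + v) a ν
  rw [add_neg_cancel_right] at h
  change _ * ((fundamentalLatticeRep N).ρ (plaquetteHolonomyZd (⇑(relabelCM (G := Matrix.specialUnitaryGroup (Fin N) ℂ)
    (edgeShift v)) U) x a ν)).trace.re = _
  rw [relabelCM_edgeShift_eq_configShift, h]

/-- ★★ **THE TRANSLATION-REDUCED SDP ON `ℤ^d` ("loops by shape", Anderson–Kruczenski / Kazakov–Zheng): the plane sum.**
For a functional feasible at level `n ≥ 4` and translation invariant on the words of length `≤ 2n` (`N ≥ 2`, `d ≥ 2`,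
`β ≥ 0`): `Σ_{ν ≠ a} φ(u_{x;aν}) ≤ (d−1)·(1 − (N − 1/N)/(4(d−1)β + N − 1/N))`. [folklore] -/
theorem sum_plaquette_le_of_translationInvariant_feasible (hN : 2 ≤ N) (hd : 2 ≤ d) {β : ℝ} (hβ : 0 ≤ β)
    {n : ℕ} (hn : 4 ≤ n) {φ : C(LGConfig d (Matrix.specialUnitaryGroup (Fin N) ℂ), ℝ) →ₗ[ℝ] ℝ}
    (hφ : IsBootstrapFeasible (fundamentalLatticeRep N) (suExp N)
      (fun e => wilsonBoundaryAction (fundamentalRep (Fin N)) {e}) β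
      (wordTruncation (ι := ZdEdge d) (fundamentalLatticeRep N) n) φ)
    (hinv : ∀ (v : Fin d → ℤ), ∀ P ∈ wordTruncation (ι := ZdEdge d) (fundamentalLatticeRep N) (n + n),
      φ (P.comp (relabelCM (G := Matrix.specialUnitaryGroup (Fin N) ℂ) (edgeShift v))) = φ P)
    (x : Site d) (a : Fin d) :
    (∑ ν ∈ Finset.univ.erase a, φ (plaquetteZdCM (fundamentalLatticeRep N) x a ν)) ≤
      ((d : ℝ) - 1) * (1 - ((N : ℝ) - 1 / N) / (4 * ((d : ℝ) - 1) * β + ((N : ℝ) - 1 / N))) := by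
  have h := TiltedRP.Equipartition.sum_plaquette_le_of_isBootstrapFeasible_zdSuN hN hn hd hβ hφ x a
  have hshift : ∀ ν, φ (plaquetteZdCM (fundamentalLatticeRep N) (x - zdUnit d ν) a ν) =
      φ (plaquetteZdCM (fundamentalLatticeRep N) x a ν) := fun ν => by
    have hm : plaquetteZdCM (fundamentalLatticeRep N) x a ν ∈
        wordTruncation (ι := ZdEdge d) (fundamentalLatticeRep N) (n + n) :=
      plaquetteZdCM_mem_wordTruncation (fundamentalLatticeRep N) (by omega) x a ν
    have h1 := hinv (-zdUnit d ν) _ hm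
    rw [plaquetteZdCM_comp_relabelCM_edgeShift, ← sub_eq_add_neg] at h1
    exact h1
  simp only [hshift, ← two_mul, ← Finset.mul_sum] at h
  linarith

/-- ★★ Set form: every translation-reduced level-`n` value (`n ≥ 4`) of the plane sum `Σ_{ν≠a} u_{x;aν}` is at most
`(d−1)(1 − δ)`; in `d = 2` the reduced SDP's plaquette upper bound is itself `≤ 1 − δ`. [folklore] -/
theorem symLevelValuesZd_planeSum_le (hN : 2 ≤ N) (hd : 2 ≤ d) {β : ℝ} (hβ : 0 ≤ β) {n : ℕ} (hn : 4 ≤ n)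
    (x : Site d) (a : Fin d) {t : ℝ}
    (ht : t ∈ symLevelValuesZdSuN (d := d) N β n (∑ ν ∈ Finset.univ.erase a, plaquetteZdCM (fundamentalLatticeRep N) x a ν)) :
    t ≤ ((d : ℝ) - 1) * (1 - ((N : ℝ) - 1 / N) / (4 * ((d : ℝ) - 1) * β + ((N : ℝ) - 1 / N))) := by
  obtain ⟨φ, hφ, hinv, rfl⟩ := ht
  rw [map_sum]
  exact sum_plaquette_le_of_translationInvariant_feasible hN hd hβ hn hφ hinv x a

end Sets

end EquipartitionZd

end Summit.QuantumFields.GaugeBoot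

end
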